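import Summits.Ventures.PercRepro.ProfileFlatUpsetLineSwap

/-!
# PercRepro — (G) AT THE PRINCIPAL UP-SET OF EVERY RANK-ONE FLAT ON `2r − 2` POINTS
(p10, gen 20; `proofs/P10-AVFULL.md` §28(g))

`M` of rank `r` on `N = 2r − 2` points, `F₀` a flat of rank `1` (a point with its parallel class), `U = principalUp M F₀`:
for a non-loop `f ∈ F₀` every separated set `Z` contains `f` (`f ∈ E ∖ Z` would give `F₀ ⊆ cl f ⊆ cl (E ∖ Z)`) and
`f ∉ cl (E ∖ Z)` for the same reason, so every negative set lies in the class `(C)` of `f` and the 114th module's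
injection `Z ↦ (E ∖ Z) ∪ f` gives `#neg ≤ #pos` (`card_negTwo_le_card_posTwo_of_rk_one`); THEOREM
`sum_sepSets_principal_nonneg_of_rk_one`.  In pointed language: the coloop limit (C1′) for a point placed parallel
to a point of `M` on `2r − 1` points (the parallel-swap case of the lane, now in the up-set language).  Census (own
code, gen 20): `#neg = #pos` in all 1,952 instances with `rk F₀ = 1` at `n = 8` and all 82 at `n = 6`.
-/

open scoped Matroid

namespace PercRepro.Cogirth

open Finset ThmH Skew

variable {α : Type} [DecidableEq α] {M : Matroid α} [M.Finite]

/-- A rank-one flat contains a non-loop. -/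
theorem exists_rk_singleton_eq_one {F₀ : Finset α} (hF : IsFlatF M F₀) (hrF : rk M F₀ = 1) :
    ∃ f ∈ F₀, rk M ({f} : Finset α) = 1 := by
  by_contra hcon
  -- every point of `F₀` is a loop, so `F₀ ⊆ cl ∅` and `rk F₀ = 0`
  have hsub : F₀ ⊆ clF M (∅ : Finset α) := by
    intro x hx
    have h1 : rk M ({x} : Finset α) ≠ 1 := fun h => hcon ⟨x, hx, h⟩
    have h2 : rk M ({x} : Finset α) ≤ 1 := by
      have := rk_le_card (M := M) ({x} : Finset α); rwa [card_singleton] at this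
    have h3 : rk M ({x} : Finset α) = 0 := by omega
    rw [mem_clF_iff_rk_insert_eq (hF.1 hx) (empty_subset _), insert_empty_eq, h3]
    have h4 : rk M (∅ : Finset α) ≤ 0 := by
      have := rk_le_card (M := M) (∅ : Finset α); rwa [card_empty] at this
    omega
  have h5 := rk_mono_fu (M := M) hsub
  rw [rk_clF_eq_fu, hrF] at h5
  have h6 : rk M (∅ : Finset α) ≤ 0 := by
    have := rk_le_card (M := M) (∅ : Finset α); rwa [card_empty] at this
  omega

/-- A rank-one flat lies in the closure of any of its non-loops. -/
theorem subset_clF_singleton_of_rk_one {F₀ : Finset α} (hF : IsFlatF M F₀) (hrF : rk M F₀ = 1) {f : α}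
    (hfF : f ∈ F₀) (hf : rk M ({f} : Finset α) = 1) : F₀ ⊆ clF M ({f} : Finset α) := by
  intro x hx
  rw [mem_clF_iff_rk_insert_eq (hF.1 hx) (singleton_subset_iff.2 (hF.1 hfF)), hf]
  apply le_antisymm
  · have := rk_mono_fu (M := M) (insert_subset hx (singleton_subset_iff.2 hfF)); omega
  · have := rk_mono_fu (M := M) (subset_insert x {f}); omega

/-- On `2r − 2` points at a rank-one flat, `#neg ≤ #pos`: every negative set is in the class `(C)` of a non-loop
`f ∈ F₀`. -/
theorem card_negTwo_le_card_posTwo_of_rk_one {F₀ : Finset α} (hF : IsFlatF M F₀)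
    (hN : (gr M).card + 2 = 2 * rk M (gr M)) (hrF : rk M F₀ = 1) : (negTwo M F₀).card ≤ (posTwo M F₀).card := by
  obtain ⟨f, hfF, hf⟩ := exists_rk_singleton_eq_one hF hrF
  have hFcl := subset_clF_singleton_of_rk_one hF hrF hfF hf
  have hfg : f ∈ gr M := hF.1 hfF
  have h1 : negTwo M F₀ ⊆ negC M F₀ f := by
    intro Z hZ
    obtain ⟨hZs, hc⟩ := mem_negTwo.1 hZ
    obtain ⟨_, hout⟩ := subset_clF_of_mem_sepSets_principal hZs
    have hfcl : f ∉ clF M (gr M \ Z) := fun h =>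
      hout (hFcl.trans (clF_subset_of_isFlatF (isFlatF_clF _) (singleton_subset_iff.2 h)))
    have hfZ : f ∈ Z := by
      by_contra hfZ
      exact hfcl (subset_clF_fu sdiff_subset (mem_sdiff.2 ⟨hfg, hfZ⟩))
    unfold negC sepC
    rw [mem_filter, mem_filter]
    exact ⟨⟨hZs, hfZ, hfcl⟩, hc⟩
  have h2 : posC M F₀ f ⊆ posTwo M F₀ := by
    intro Z hZ
    unfold posC sepC at hZ
    rw [mem_filter, mem_filter] at hZ
    exact mem_posTwo.2 ⟨hZ.1.1, hZ.2⟩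
  exact (card_le_card h1).trans ((card_negC_le_card_posC hF hN hfF).trans (card_le_card h2))

/-- **(G) AT THE PRINCIPAL UP-SET OF EVERY RANK-ONE FLAT ON `2r − 2` POINTS.** -/
theorem sum_sepSets_principal_nonneg_of_rk_one {F₀ : Finset α} (hF : IsFlatF M F₀)
    (hN : (gr M).card + 2 = 2 * rk M (gr M)) (hrF : rk M F₀ = 1) :
    0 ≤ ∑ Z ∈ sepSets M (principalUp M F₀), (2 * (Z.card : ℤ) - (gr M).card - 1) := by
  rw [sum_term_eq_of_subset hF hN (Subset.refl _)]
  have hP : (sepSets M (principalUp M F₀)).filter (fun Z => Z ∈ posTwo M F₀) = posTwo M F₀ := by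
    ext Z; rw [mem_filter]; exact ⟨fun h => h.2, fun h => ⟨(mem_posTwo.1 h).1, h⟩⟩
  have hN' : (sepSets M (principalUp M F₀)).filter (fun Z => Z ∈ negTwo M F₀) = negTwo M F₀ := by
    ext Z; rw [mem_filter]; exact ⟨fun h => h.2, fun h => ⟨(mem_negTwo.1 h).1, h⟩⟩
  rw [hP, hN']
  have := card_negTwo_le_card_posTwo_of_rk_one hF hN hrF
  have h' : ((negTwo M F₀).card : ℤ) ≤ (posTwo M F₀).card := by exact_mod_cast this
  linarith

end PercRepro.Cogirth
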